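import Summits.BirchSwinnertonDyer.BirchSwinnertonDyer.Theorems.SignedLowerHalvesSprungLowerDivisibilityAtThreeIotaDoorContraStubs
import Summits.BirchSwinnertonDyer.BirchSwinnertonDyer.Theorems.SignedLowerHalvesSprungLowerDivisibilityAtThreeCyclotomicPosLevelLedgerOrbit
import HarnessLib

/-!
# Crux `SprungLowerDivisibilityAtThree` (item stmt-BirchSwinnertonDyer-19875), line `chromatic-common-zeros`: THE ι-DOORS OF THE PRINT-KEYED
# TWIN CRUXES K′ / C′ (route `PrintX8VSC`, director-bsd (288)(a) GO 2026-08-28T22:02:56Z), CLOSED from the four printed F-α♮ inputs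

Cell `bsd-ssimc` (host), LEAD seat `cruxlead-stmt-BirchSwinnertonDyer-19875` (gen 7); `--supports` stmt-BirchSwinnertonDyer-19875 `--as helper`;
theorems only (no `def`, no named fact, no instance); closes NO item. HONEST FRAMING: compositions of landed lemmas — w2 g9's Contra F-α♮
telescope `cokerBoundIotaOffT_contra_of_poitouTate'` (p668503; from `Sprung2012.thm714seq_sharpFlat_poitouTate_functionalModel`, `Kato2004.thm12_4`,
`matar2020_thm11_selmerDualTorsion_pseudoIso_fineSelmerDual`, `Kato2004_fineSelmerDual_isTorsion` — PUBLISHED theorems typed statement-only, taken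
here as displayed hypotheses, never discharged) with w3 g9's door-at-one-prime `katoFineLowerAt_of_iotaDoor_contra[_of_comap_invol_eq]` (p670914).
The three theorems are, SIGNATURE FOR SIGNATURE, the door stubs of the x8 birth skeletons v2 of the PrintX8VSC cruxes
(`pub/bsd-print-x8/bsd-print-x8-plan/twinC-g33/bc/*_birth.lean`, K 2c6ef8d99fff950d / C 236f60df55bb0913) and of the LEAD's K-form C′ skeleton
(crux dir of 19875, `Lines/twinC_{K,C}prime_iota_door_contra_LEADg7.lean`), whose door decls become one-line references to this file; what is
LEFT on each twin crux is ONE research stub (K′: Kato 12.10 ⊆ at the sporadic ι-orbits with `j(ι𝔭) < k(𝔭)`; C′: Sprung 7.21 ⊆ at the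
positive-level cyclotomic common zeros with `j(𝔭) < k(𝔭)`), OPEN in print at `(3, a₃ = ±3)`. K′, C′, K1, K_spor, leaf X8 and BSD are NOT proved.

* §1 `iotaDoorContra_sporadic_of_printedFacts` — K′'s door (sporadic `𝔭`, door `k(𝔭) ≤ j(ι𝔭)`, F-α♮ read at the MIRROR prime).
* §2 `iotaDoorContra_posLevel_of_printedFacts` — C′'s K-form door (positive-level cyclotomic `𝔭`, `ι𝔭 = 𝔭`, door `k ≤ j`).
* §3 `cyclotomicDoorMForm_contra` — the x8 birth skeleton's `m`-form door for C′ (`m ≤ j(ι𝔭)` ⟹ `m ≤ ℓ D′.X`) WITHOUT its four idle fact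
  binders: FACT-FREE (the door forces `k = 0`) — recorded to show why the line registers the K-form instead (`{j < m}` ⊋ `{j < k}`).

References: [Kato2004Asterisque] Thm. 12.4 (p. 221), Thm. 12.5 (p. 222), Conj. 12.10 (p. 224), (17.13.1) (p. 279–280); [Sprung2012] Def. 6.1,
Thm. 7.14 (3) (p. 1504), Prop. 7.19, Main Conj. 7.21 (p. 1505); [Matar2020] Thm. 1.1; [Wingberg1989] Cor. 2.5; [Kobayashi2003] Prop. 7.1, Thm. 7.3.
-/

set_option linter.dupNamespace false
set_option autoImplicit false

noncomputable section

open scoped Classical NumberField MatrixGroups ModularForm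

open NumberField IsDedekindDomain CongruenceSubgroup WeierstrassCurve Field
  Literature.NumberTheory.EllipticCurves Literature.NumberTheory.EllipticCurves.ModularForms
  Literature.NumberTheory.EllipticCurves.ZpExtension Literature.NumberTheory.EllipticCurves.Sprung2017
  Literature.NumberTheory.EllipticCurves.Sprung2012 Literature.NumberTheory.EllipticCurves.Rank1Residual
  Literature.NumberTheory.EllipticCurves.IwasawaAlgebra Literature.NumberTheory.EllipticCurves.Kato2004
  Literature.NumberTheory.EllipticCurves.Module
  Summit.BirchSwinnertonDyer.BirchSwinnertonDyer.Theorems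

namespace Summit.BirchSwinnertonDyer.BirchSwinnertonDyer.Theorems.ChromaticCommonZeros

/-! ### §1 The sporadic door (crux K′ `KatoFineLowerSporadicGivenHeldX8Contra`) -/

/-- **THE ι-DOOR IN PRINT CURRENCY — x8 birth stub `stub_iotaDoorContra` (v2), SIGNATURE VERBATIM, PROVED** from its four displayed inputs
(Sprung (3)/(7.18)∞ Poitou–Tate functional model, Kato Thm 12.4, Matar 2020 Thm 1.1, Kato's fine-dual torsion): at a sporadic height-one `𝔭` (`p ∉ 𝔭`, no `ω̃ₙ ∈ 𝔭`), common zero of both normalised colours,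
INSIDE the door `ℓ_𝔭(I.H ⧸ Cs.Z) ≤ min_• ℓ_{ι𝔭}(Λ ⧸ range C•.colMap)`, Kato's fine inequality `ℓ_𝔭(I.H ⧸ Cs.Z) ≤ ℓ_𝔭 Y′.X` holds for the
natural-keyed `Y′ : FineSelmerDualData κ γ⁻¹`. Proof: the mirror prime `ι𝔭` is height one with `p, T ∉ ι𝔭`; if `ι𝔭` is a common zero,
the Contra F-α♮ telescope at `ι𝔭` (`ChromaticCommonZeros.cokerBoundIotaOffT_contra_of_poitouTate'`, w2 g9 p668503) gives
`j(ι𝔭) ≤ x′(ιι𝔭) = x′(𝔭)`; otherwise `j(ι𝔭) = 0`; either way `ChromaticCommonZeros.katoFineLowerAt_of_iotaDoor_contra` (w3 g9 p670914).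
[cite: Kato2004Asterisque, Thm. 12.4 (p. 221), (17.13.1) (p. 279–280)] [cite: Sprung2012, Thm. 7.14 (3) (p. 1504)] [cite: Matar2020, Thm. 1.1]
[cite: Kobayashi2003, Prop. 7.1, Thm. 7.3 (pp. 12–13)] [cite: Wingberg1989, Cor. 2.5] -/
theorem iotaDoorContra_sporadic_of_printedFacts :
    thm714seq_sharpFlat_poitouTate_functionalModel → Kato2004.thm12_4 →
    matar2020_thm11_selmerDualTorsion_pseudoIso_fineSelmerDual → Kato2004_fineSelmerDual_isTorsion →
    ∀ (W : WeierstrassCurve ℚ) [W.IsElliptic] [W.IsGloballyMinimal] (p : ℕ) [Fact p.Prime]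
      [ContinuousSMul ℤ_[p] (W.tateModule p)] [Module.Free ℤ_[p] (W.tateModule p)]
      [Module.Finite ℤ_[p] (W.tateModule p)],
      ClassX8 W p → ∀ (κ : ZpExtension ℚ p) (γ : Field.absoluteGaloisGroup ℚ),
      κ.IsCyclotomic → κ.IsTopGenerator γ → IsCyclotomicVariable p γ →
    ∀ (v : HeightOneSpectrum (𝓞 ℚ)), (p : 𝓞 ℚ) ∈ v.asIdeal →
    ∀ (g : Field.absoluteGaloisGroup (v.adicCompletion ℚ)),
      κ.IsTopGenerator (resGalOfEmb (closureEmb (K := ℚ) (v.adicCompletion ℚ)) g) →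
    ∀ (cneg : localPoints W (v.adicCompletion ℚ)) (c : ℕ → localPoints W (v.adicCompletion ℚ)),
      IsHondaSystem κ (closureEmb (K := ℚ) (v.adicCompletion ℚ)) W (W.frobeniusTrace p) g cneg c →
    ∀ (N : ℕ) (_ : NeZero N) (f : CuspForm (Gamma0 N) 2) (ϖ : ℚ) (Lsharp Lflat : IwasawaAlgebra p),
      IsNewformOf W f → (ϖ : ℝ) * W.realPeriodRat = plusPeriod f →
      IsSprungPair f p (W.frobeniusTrace p) Lsharp Lflat →
    ∀ (I : Kato2004.IwasawaH1Data W p κ γ)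
      (Cs : SharpFlatColemanKatoDataContra W p f ϖ κ γ (closureEmb (K := ℚ) (v.adicCompletion ℚ))
        (W.frobeniusTrace p) g c Chroma.sharp I)
      (Cf : SharpFlatColemanKatoDataContra W p f ϖ κ γ (closureEmb (K := ℚ) (v.adicCompletion ℚ))
        (W.frobeniusTrace p) g c Chroma.flat I),
      Cs.Z = Cf.Z →
    ∀ (Y : W.FineSelmerDualData κ γ⁻¹) (𝔭 : PrimeSpectrum (IwasawaAlgebra p)), 𝔭.asIdeal.height = 1 →
      (p : IwasawaAlgebra p) ∉ 𝔭.asIdeal →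
      (¬ ∃ n : ℕ, ((cyclotomicOmega p n).map (Int.castRingHom ℤ_[p]) : PowerSeries ℤ_[p]) ∈ 𝔭.asIdeal) →
      (∀ (col' : Chroma) (G' : IwasawaAlgebra p),
        iwasawaToPowerSeries p G' =
          PowerSeries.C (ϖ : ℚ_[p]) * iwasawaToPowerSeries p (chromaticL col' Lsharp Lflat) →
        G' ∈ 𝔭.asIdeal) →
      Module.lengthAt (IwasawaAlgebra p) (I.H ⧸ Cs.Z) 𝔭 ≤
          min (Module.lengthAt (IwasawaAlgebra p) (IwasawaAlgebra p ⧸ LinearMap.range Cs.colMap)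
                (PrimeSpectrum.comap (invol p).toRingHom 𝔭))
            (Module.lengthAt (IwasawaAlgebra p) (IwasawaAlgebra p ⧸ LinearMap.range Cf.colMap)
                (PrimeSpectrum.comap (invol p).toRingHom 𝔭)) →
      Module.lengthAt (IwasawaAlgebra p) (I.H ⧸ Cs.Z) 𝔭 ≤ Module.lengthAt (IwasawaAlgebra p) Y.X 𝔭 := by
  intro hPT h124 hMatar hfine W _ _ p _ _ _ _ hX κ γ hκ hγ hcv v hv g hg cneg c hH N hN f ϖ Lsharp Lflat hf hϖ hSP I Cs Cf hZ Y 𝔭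
    h𝔭 hp𝔭 hspor hcommon hdoor
  haveI : NeZero N := hN
  -- `T ∉ 𝔭` (sporadic: `ω̃₀ = T`)
  have hT : (PowerSeries.X : IwasawaAlgebra p) ∉ 𝔭.asIdeal := fun hT =>
    hspor ⟨0, by rwa [ChromaticCommonZeros.coe_map_cyclotomicOmega_zero]⟩
  -- the mirror prime `ι𝔭`: height one, `p ∉ ι𝔭`, `T ∉ ι𝔭`
  obtain ⟨h𝔮, hp𝔮⟩ := ChromaticCommonZeros.comap_invol_heightOne_not_mem 𝔭 h𝔭 hp𝔭
  have hT𝔮 := ChromaticCommonZeros.X_not_mem_comap_invol 𝔭 hT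
  have hs : chromaticL Chroma.sharp Lsharp Lflat ≠ 0 :=
    ChromaticBothColours.ClassX8.chromaticL_ne_zero W p hX f Lsharp Lflat hf hSP Chroma.sharp
  have hfl : chromaticL Chroma.flat Lsharp Lflat ≠ 0 :=
    ChromaticBothColours.ClassX8.chromaticL_ne_zero W p hX f Lsharp Lflat hf hSP Chroma.flat
  refine ChromaticCommonZeros.katoFineLowerAt_of_iotaDoor_contra W p Cs Cf (ClassX8.irr' W p hX) hSP hs hfl Y 𝔭
    (PrimeSpectrum.comap (invol p).toRingHom 𝔭) h𝔮 ?_ hdoor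
  intro hcommon𝔮
  have h := ChromaticCommonZeros.cokerBoundIotaOffT_contra_of_poitouTate' hPT h124 hMatar hfine W p hX κ γ hκ hγ
    hcv v hv g hg cneg c hH N hN f ϖ Lsharp Lflat hf hϖ hSP I Cs Cf hZ Y (PrimeSpectrum.comap (invol p).toRingHom 𝔭)
    h𝔮 hp𝔮 hT𝔮 hcommon𝔮
  rwa [Kato2004.comap_invol_comap_invol] at h

/-! ### §2 The K-form door at the positive-level cyclotomic primes (crux C′ `CyclotomicLowerPosLevelGivenHeldX8Contra`) -/

/-- **THE K-FORM DOOR AT A POSITIVE-LEVEL CYCLOTOMIC PRIME, from the four displayed F-α♮ inputs** (PT functional model, Kato 12.4, Matar 1.1,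
Kato fine torsion): over the same binders as the
residue stub, at a height-one `𝔭` with `T ∉ 𝔭 ∋ Φ_{3^j}(1+T)` (`j ≥ 1`), common zero of both normalised colours, INSIDE the door
`ℓ_𝔭(I.H ⧸ Cs.Z) ≤ min_• ℓ_𝔭(Λ ⧸ range C•.colMap)`: `ℓ_𝔭(I.H ⧸ Cs.Z) ≤ ℓ_𝔭 Y′.X`. Proof: `𝔭` is `ι`-fixed and `3 ∉ 𝔭`; the Contra F-α♮
telescope at `𝔭` (`ChromaticCommonZeros.cokerBoundIotaOffT_contra_of_poitouTate'`, w2 g9 p668503) reads `j(𝔭) ≤ x′(ι𝔭) = x′(𝔭)`;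
compose (`ChromaticCommonZeros.katoFineLowerAt_of_iotaDoor_contra_of_comap_invol_eq`, w3 g9 p670914).
[cite: Kato2004Asterisque, Thm. 12.4 (p. 221), (17.13.1) (p. 279–280)] [cite: Sprung2012, Thm. 7.14 (3) (p. 1504)] [cite: Matar2020, Thm. 1.1]
[cite: Kobayashi2003, Prop. 7.1, Thm. 7.3 (pp. 12–13)] [cite: Wingberg1989, Cor. 2.5] -/
theorem iotaDoorContra_posLevel_of_printedFacts (hPT : thm714seq_sharpFlat_poitouTate_functionalModel) (h124 : Kato2004.thm12_4)
    (hMatar : matar2020_thm11_selmerDualTorsion_pseudoIso_fineSelmerDual) (hfine : Kato2004_fineSelmerDual_isTorsion) :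
    ∀ (W : WeierstrassCurve ℚ) [W.IsElliptic] [W.IsGloballyMinimal] (p : ℕ) [Fact p.Prime]
      [ContinuousSMul ℤ_[p] (W.tateModule p)] [Module.Free ℤ_[p] (W.tateModule p)]
      [Module.Finite ℤ_[p] (W.tateModule p)],
      ClassX8 W p → ∀ (κ : ZpExtension ℚ p) (γ : Field.absoluteGaloisGroup ℚ),
      κ.IsCyclotomic → κ.IsTopGenerator γ → IsCyclotomicVariable p γ →
    ∀ (v : HeightOneSpectrum (𝓞 ℚ)), (p : 𝓞 ℚ) ∈ v.asIdeal →
    ∀ (g : Field.absoluteGaloisGroup (v.adicCompletion ℚ)),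
      κ.IsTopGenerator (resGalOfEmb (closureEmb (K := ℚ) (v.adicCompletion ℚ)) g) →
    ∀ (cneg : localPoints W (v.adicCompletion ℚ)) (c : ℕ → localPoints W (v.adicCompletion ℚ)),
      IsHondaSystem κ (closureEmb (K := ℚ) (v.adicCompletion ℚ)) W (W.frobeniusTrace p) g cneg c →
    ∀ (N : ℕ) (_ : NeZero N) (f : CuspForm (Gamma0 N) 2) (ϖ : ℚ) (Lsharp Lflat : IwasawaAlgebra p),
      IsNewformOf W f → (ϖ : ℝ) * W.realPeriodRat = plusPeriod f →
      IsSprungPair f p (W.frobeniusTrace p) Lsharp Lflat →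
    ∀ (I : Kato2004.IwasawaH1Data W p κ γ)
      (Cs : SharpFlatColemanKatoDataContra W p f ϖ κ γ (closureEmb (K := ℚ) (v.adicCompletion ℚ))
        (W.frobeniusTrace p) g c Chroma.sharp I)
      (Cf : SharpFlatColemanKatoDataContra W p f ϖ κ γ (closureEmb (K := ℚ) (v.adicCompletion ℚ))
        (W.frobeniusTrace p) g c Chroma.flat I),
      Cs.Z = Cf.Z →
    ∀ (Y : W.FineSelmerDualData κ γ⁻¹) (𝔭 : PrimeSpectrum (IwasawaAlgebra p)), 𝔭.asIdeal.height = 1 →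
      (PowerSeries.X : IwasawaAlgebra p) ∉ 𝔭.asIdeal →
      (∃ j : ℕ, 1 ≤ j ∧
        ((((Polynomial.cyclotomic (p ^ j) ℤ).comp (Polynomial.X + 1)).map (Int.castRingHom ℤ_[p]) : Polynomial ℤ_[p]) :
          PowerSeries ℤ_[p]) ∈ 𝔭.asIdeal) →
      (∀ (col' : Chroma) (G' : IwasawaAlgebra p),
        iwasawaToPowerSeries p G' =
          PowerSeries.C (ϖ : ℚ_[p]) * iwasawaToPowerSeries p (chromaticL col' Lsharp Lflat) →
        G' ∈ 𝔭.asIdeal) →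
      Module.lengthAt (IwasawaAlgebra p) (I.H ⧸ Cs.Z) 𝔭 ≤
          min (Module.lengthAt (IwasawaAlgebra p) (IwasawaAlgebra p ⧸ LinearMap.range Cs.colMap) 𝔭)
            (Module.lengthAt (IwasawaAlgebra p) (IwasawaAlgebra p ⧸ LinearMap.range Cf.colMap) 𝔭) →
      Module.lengthAt (IwasawaAlgebra p) (I.H ⧸ Cs.Z) 𝔭 ≤ Module.lengthAt (IwasawaAlgebra p) Y.X 𝔭 := by
  intro W _ _ p _ _ _ _ hX κ γ hκ hγ hcv v hv g hg cneg c hH N hN f ϖ Lsharp Lflat hf hϖ hSP I Cs Cf hZ Y 𝔭 h𝔭 hT hΦ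
    hcommon hdoor
  haveI : NeZero N := hN
  obtain ⟨j, hj1, hΦj⟩ := hΦ
  have hp3 : p = 3 := hX.1
  subst hp3
  -- `3 ∉ 𝔭` and `ι𝔭 = 𝔭` at a positive-level cyclotomic prime
  have hp𝔭 : ((3 : ℕ) : IwasawaAlgebra 3) ∉ 𝔭.asIdeal :=
    ChromaticCommonZeros.natCast_not_mem_of_cyclotomic_comp_mem 𝔭 h𝔭 hj1 hΦj
  have hfix : PrimeSpectrum.comap (invol 3).toRingHom 𝔭 = 𝔭 :=
    ChromaticCommonZeros.comap_invol_eq_self_of_cyclotomic_comp_mem 𝔭 h𝔭 hj1 hΦj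
  have hs : chromaticL Chroma.sharp Lsharp Lflat ≠ 0 :=
    ChromaticBothColours.ClassX8.chromaticL_ne_zero W 3 hX f Lsharp Lflat hf hSP Chroma.sharp
  have hfl : chromaticL Chroma.flat Lsharp Lflat ≠ 0 :=
    ChromaticBothColours.ClassX8.chromaticL_ne_zero W 3 hX f Lsharp Lflat hf hSP Chroma.flat
  refine ChromaticCommonZeros.katoFineLowerAt_of_iotaDoor_contra_of_comap_invol_eq W 3 Cs Cf (ClassX8.irr' W 3 hX) hSP hs hfl
    Y 𝔭 h𝔭 hfix ?_ hdoor
  intro hcommon'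
  exact ChromaticCommonZeros.cokerBoundIotaOffT_contra_of_poitouTate' hPT h124 hMatar hfine W 3 hX κ γ hκ hγ hcv v hv
    g hg cneg c hH N hN f ϖ Lsharp Lflat hf hϖ hSP I Cs Cf hZ Y 𝔭 h𝔭 hp𝔭 hT hcommon'

/-! ### §3 The `m`-form door of the x8 birth skeleton for C′ (fact-free) -/

/-- **The x8 birth skeleton's `m`-FORM DOOR for C′, FACT-FREE — and why the line does not use it.** At a positive-level cyclotomic prime
`𝔭` (`ι𝔭 = 𝔭`), inside the door `ℓ_𝔭 Λ/(G) ≤ min_• ℓ_{ι𝔭}(Λ ⧸ range C•.colMap)`: the content identity `m^• = k + c^•`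
(`SharpFlatColemanKatoDataContra.lengthAt_quotient_span_eq_zeta_add_range`) and `min_• c^• ≤ c^•` force the zeta index `k(𝔭) = 0`, whence
`k ≤ x′` trivially and `m^• ≤ ℓ_𝔭 D′.X` by the four-term identity `SharpFlatColemanKatoDataContra.lengthAt_add_eq` — NO F-α♮ input is used
(the birth stub `stub_iotaDoorContra` = this after four idle fact binders). Hence the `m`-door is the locus `{k = 0 ∧ c^• = j}` and its
complement `{j < m}` would put every cyclotomic common zero with positive zeta index into the residue; the line's K-form door (§2) is strictly
larger. [cite: Sprung2012, Def. 6.1 (p. 1495), Thm. 7.14 (3) (p. 1504), Prop. 7.19 (p. 1505)] [cite: Kato2004Asterisque, Thm. 12.5 (p. 222), §17.13 (p. 280)] -/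
theorem cyclotomicDoorMForm_contra :
    ∀ (W : WeierstrassCurve ℚ) [W.IsElliptic] [W.IsGloballyMinimal] (p : ℕ) [Fact p.Prime]
      [ContinuousSMul ℤ_[p] (W.tateModule p)] [Module.Free ℤ_[p] (W.tateModule p)]
      [Module.Finite ℤ_[p] (W.tateModule p)],
      ClassX8 W p → ∀ (col : Chroma) (κ : ZpExtension ℚ p) (γ : Field.absoluteGaloisGroup ℚ),
      κ.IsCyclotomic → κ.IsTopGenerator γ → IsCyclotomicVariable p γ →
    ∀ (v : HeightOneSpectrum (𝓞 ℚ)), (p : 𝓞 ℚ) ∈ v.asIdeal →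
    ∀ (g : Field.absoluteGaloisGroup (v.adicCompletion ℚ)),
      κ.IsTopGenerator (resGalOfEmb (closureEmb (K := ℚ) (v.adicCompletion ℚ)) g) →
    ∀ (cneg : localPoints W (v.adicCompletion ℚ)) (c : ℕ → localPoints W (v.adicCompletion ℚ)),
      IsHondaSystem κ (closureEmb (K := ℚ) (v.adicCompletion ℚ)) W (W.frobeniusTrace p) g cneg c →
    ∀ (N : ℕ) (_ : NeZero N) (f : CuspForm (Gamma0 N) 2) (ϖ : ℚ) (Lsharp Lflat : IwasawaAlgebra p),
      IsNewformOf W f → (ϖ : ℝ) * W.realPeriodRat = plusPeriod f →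
      IsSprungPair f p (W.frobeniusTrace p) Lsharp Lflat → chromaticL col Lsharp Lflat ≠ 0 →
    ∀ (D : SharpFlatSelmerDualData W κ γ⁻¹ (closureEmb (K := ℚ) (v.adicCompletion ℚ))
        (W.frobeniusTrace p) g c col) [Module.Finite (IwasawaAlgebra p) D.X],
      Module.IsTorsion (IwasawaAlgebra p) D.X →
    ∀ (G : IwasawaAlgebra p),
      iwasawaToPowerSeries p G =
        PowerSeries.C (ϖ : ℚ_[p]) * iwasawaToPowerSeries p (chromaticL col Lsharp Lflat) →
    ∀ (I : Kato2004.IwasawaH1Data W p κ γ)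
      (Cs : SharpFlatColemanKatoDataContra W p f ϖ κ γ (closureEmb (K := ℚ) (v.adicCompletion ℚ))
        (W.frobeniusTrace p) g c Chroma.sharp I)
      (Cf : SharpFlatColemanKatoDataContra W p f ϖ κ γ (closureEmb (K := ℚ) (v.adicCompletion ℚ))
        (W.frobeniusTrace p) g c Chroma.flat I),
      Cs.Z = Cf.Z →
    ∀ 𝔭 : PrimeSpectrum (IwasawaAlgebra p), 𝔭.asIdeal.height = 1 →
      (PowerSeries.X : IwasawaAlgebra p) ∉ 𝔭.asIdeal →
      (∃ j : ℕ, 1 ≤ j ∧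
        ((((Polynomial.cyclotomic (p ^ j) ℤ).comp (Polynomial.X + 1)).map (Int.castRingHom ℤ_[p]) : Polynomial ℤ_[p]) :
          PowerSeries ℤ_[p]) ∈ 𝔭.asIdeal) →
      (∀ (col' : Chroma) (G' : IwasawaAlgebra p),
        iwasawaToPowerSeries p G' =
          PowerSeries.C (ϖ : ℚ_[p]) * iwasawaToPowerSeries p (chromaticL col' Lsharp Lflat) →
        G' ∈ 𝔭.asIdeal) →
      Module.lengthAt (IwasawaAlgebra p) (IwasawaAlgebra p ⧸ Ideal.span {G}) 𝔭 ≤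
          min (Module.lengthAt (IwasawaAlgebra p) (IwasawaAlgebra p ⧸ LinearMap.range Cs.colMap)
                (PrimeSpectrum.comap (invol p).toRingHom 𝔭))
            (Module.lengthAt (IwasawaAlgebra p) (IwasawaAlgebra p ⧸ LinearMap.range Cf.colMap)
                (PrimeSpectrum.comap (invol p).toRingHom 𝔭)) →
      Module.lengthAt (IwasawaAlgebra p) (IwasawaAlgebra p ⧸ Ideal.span {G}) 𝔭 ≤
        Module.lengthAt (IwasawaAlgebra p) D.X 𝔭 := by
  intro W _ _ p _ _ _ _ hX col κ γ hκ hγ hcv v hv g hg cneg c hH N hN f ϖ Lsharp Lflat hf hϖ hSP hcol D _ hXt G hG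
    I Cs Cf hZ 𝔭 h𝔭 hT hΦ hcommon hle
  haveI : NeZero N := hN
  obtain ⟨j, hj1, hΦj⟩ := hΦ
  have hp3 : p = 3 := hX.1
  subst hp3
  -- `ι𝔭 = 𝔭`
  rw [ChromaticCommonZeros.comap_invol_eq_self_of_cyclotomic_comp_mem 𝔭 h𝔭 hj1 hΦj] at hle
  have hirr : W.HasIrreducibleModPGaloisRep 3 := ClassX8.irr' W 3 hX
  -- a natural-keyed fine datum (the `ι`-twist of the tree's `γ`-keyed one), for the four-term identity
  obtain ⟨Y₀⟩ := W.nonempty_fineSelmerDualData κ hγ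
  obtain ⟨Y, -, -, -⟩ := Kato2004.fineSelmerDualData_exists_involTwist (mul_inv_cancel γ) Y₀
  -- `G ≠ 0`, so `m = ℓ_𝔭 Λ/(G)` is finite; `ℓ_𝔭 D′.X` is finite (torsion)
  have hϖ0 : ϖ ≠ 0 := hf.periodRatio_ne_zero hϖ
  have hG0 : G ≠ 0 := by
    intro h0
    rw [h0, map_zero, eq_comm, mul_eq_zero] at hG
    rcases hG with hC | hL
    · have h1 : ((ϖ : ℚ) : ℚ_[3]) = 0 := by simpa using congrArg PowerSeries.constantCoeff hC
      exact hϖ0 (by exact_mod_cast h1)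
    · exact hcol (iwasawaToPowerSeries_injective 3 (by rw [hL, map_zero]))
  have hm : Module.lengthAt (IwasawaAlgebra 3) (IwasawaAlgebra 3 ⧸ Ideal.span {G}) 𝔭 ≠ ⊤ :=
    lengthAt_ne_top_of_isTorsionBy hG0 (ChromaticCommonZeros.isTorsionBy_quotient_span_singleton G) 𝔭 (le_of_eq h𝔭)
  have hD : Module.lengthAt (IwasawaAlgebra 3) D.X 𝔭 ≠ ⊤ :=
    IwasawaAlgebra.lengthAt_ne_top_of_isTorsion_of_height_le_one 3 D.X hXt 𝔭 h𝔭.le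
  cases col with
  | sharp =>
    -- content identity `m = k + c♯`; the door `m ≤ c♯` forces `k = 0`
    have hid := Cs.lengthAt_quotient_span_eq_zeta_add_range W 3 hirr hSP hcol hG 𝔭 h𝔭
    have hc : Module.lengthAt (IwasawaAlgebra 3) (IwasawaAlgebra 3 ⧸ LinearMap.range Cs.colMap) 𝔭 ≠ ⊤ :=
      ne_top_of_le_ne_top hm (hid ▸ le_add_self)
    have hk0 : Module.lengthAt (IwasawaAlgebra 3) (I.H ⧸ Cs.Z) 𝔭 ≤ 0 := by
      have h := hle.trans (min_le_left _ _)
      rw [hid] at h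
      exact (ENat.add_le_add_iff_right hc).1 (by simpa using h)
    have hkT : Module.lengthAt (IwasawaAlgebra 3) (I.H ⧸ Cs.Z) 𝔭 ≠ ⊤ := ne_top_of_le_ne_top ENat.zero_ne_top hk0
    exact ChromaticCommonZeros.le_of_add_eq_add_of_le_of_ne_top (Cs.lengthAt_add_eq W 3 hirr hSP hcol hG D Y 𝔭 h𝔭)
      (hk0.trans bot_le) hD hkT
  | flat =>
    have hid := Cf.lengthAt_quotient_span_eq_zeta_add_range W 3 hirr hSP hcol hG 𝔭 h𝔭
    have hc : Module.lengthAt (IwasawaAlgebra 3) (IwasawaAlgebra 3 ⧸ LinearMap.range Cf.colMap) 𝔭 ≠ ⊤ :=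
      ne_top_of_le_ne_top hm (hid ▸ le_add_self)
    have hk0 : Module.lengthAt (IwasawaAlgebra 3) (I.H ⧸ Cf.Z) 𝔭 ≤ 0 := by
      have h := hle.trans (min_le_right _ _)
      rw [hid] at h
      exact (ENat.add_le_add_iff_right hc).1 (by simpa using h)
    have hkT : Module.lengthAt (IwasawaAlgebra 3) (I.H ⧸ Cf.Z) 𝔭 ≠ ⊤ := ne_top_of_le_ne_top ENat.zero_ne_top hk0
    exact ChromaticCommonZeros.le_of_add_eq_add_of_le_of_ne_top (Cf.lengthAt_add_eq W 3 hirr hSP hcol hG D Y 𝔭 h𝔭)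
      (hk0.trans bot_le) hD hkT

end Summit.BirchSwinnertonDyer.BirchSwinnertonDyer.Theorems.ChromaticCommonZeros

end
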